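import Literature.NumberTheory.EllipticCurves.FormalLeafDenominatorsProofs
import Mathlib.NumberTheory.Padics.PadicVal.Basic
import Mathlib.Data.Nat.Factorization.Basic
import Mathlib.Analysis.SpecialFunctions.Pow.Real
import Mathlib.Analysis.SpecialFunctions.Exp
import HarnessLib

/-!
# A geometric common denominator for the formal leaf `y = exp_{E'}(log_E x)`
(Bost 2001, Prop. 3.9 (2) ⇒ `Σ_p log R_p⁻¹ < ∞`; proofs only)

Topic `Literature/NumberTheory/EllipticCurves`; a proofs-only file (theorems only, no definition,
no named fact). It packages the `p`-adic estimates of `FormalLeafDenominatorsProofs` (for two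
Weierstrass equations `W, W'` over `ℤ`: `n!·[xⁿ](yʲ) ∈ ℤ` always, and `∈ p^{⌊n/p⌋}ℤ` at every odd
prime `p` at which the Hasse invariants agree) into the single hypothesis consumed by André's
algebraicity criterion over `ℚ` in the tree's form (`Transcendental/AndreCriterion…`,
Chambert-Loir, Sém. Bourbaki 886, §6.3: rows `m ↦ ([xᵐ] xᵃ y(x)ᵇ)_{a,b}` with integer
denominators `Den m`): **there is `Den : ℕ → ℕ`, `0 < Den n ≤ Cⁿ`, with
`Den n · [xᵐ](yʲ) ∈ ℤ` for all `m ≤ n` and all `j`** (`exists_den_leaf`), and the same for two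
elliptic curves over `ℚ` with `a_p(E) = a_p(E')` for almost all `p` (`exists_den_leaf_of_finite`,
where `y = exp_{E'}(log_E x)` is taken for globally minimal equations `E, E'`).

The denominator is `Den n = ∏_{p ≤ n} p^{e_p(n)}` with `e_p(n) = v_p(n!)` for `p` in the finite
exceptional set `S` (containing `2`, the primes dividing `Δ_E Δ_{E'}` and those with
`a_p ≠ a'_p`) and `e_p(n) = v_p(⌊n/p⌋!) = v_p(n!) - ⌊n/p⌋` otherwise (Legendre). Its growth:
`p^{v_p(n!)} ≤ pⁿ` for `p ∈ S`, and `p^{v_p(⌊n/p⌋!)} ≤ p^{n/(p(p-1))}` (`(p-1)·v_p(k!) ≤ k`),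
while `∏_{2 ≤ m ≤ n} m^{1/(m(m-1))} ≤ 2e²` for all `n` (`prod_rpow_le`: with
`Q_n = P_n · n^{1/n}` one has `Q_{n+1} = Q_n (1 + 1/n)^{1/n} ≤ Q_n e^{1/n²}`); so
`Den n ≤ (2e² · ∏_{p ∈ S} p)ⁿ`. This is Bost's `Σ_p log R_p⁻¹ < ∞` (Prop. 3.9 (2):
`log R_p⁻¹ ≤ 3[K_p : ℚ_p] log p / p²`) for the leaf of `E × E'`, in the elementary dress of a
common denominator.

* `factorization_prod_prime_pow`, `int_factorial_dvd_of_factorization_le`,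
  `padicValNat_factorial_eq_div_add` (Legendre `v_p(m!) = v_p(⌊m/p⌋!) + ⌊m/p⌋`),
  `factorization_factorial_mono` — the arithmetic;
* `one_add_inv_rpow_inv_le`, `prod_rpow_mul_rpow_le`, `prod_rpow_le`,
  `pow_padicValNat_factorial_div_le`, `prod_prime_pow_padicValNat_factorial_div_le` — the growth;
* `exists_den_leaf`, `exists_den_leaf_of_finite` — **the packaged denominators**.

What is left of Bost's proof of Cor. 2.5 for the tree after this file: the identification of the
formal leaf with the analytic one (`log_E` of the Taylor series of `t(u(z))`, `t = -x/y`, is `z`)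
and the assembly with the criterion (`Transcendental/AndreCriterion…`) and
`isIsogenous_of_evalEval_comp_eq_zero` (`IsogenyOfAlgebraicDependenceProofs`).

## References

* J.-B. Bost, *Algebraic leaves of algebraic foliations over number fields*, Publ. Math. IHÉS 93
  (2001), Prop. 3.9 (2), (3.9)–(3.10), and §3.4.3. [Bost2001AlgebraicLeaves]
* A. Chambert-Loir, Sém. Bourbaki 886, Astérisque 282 (2002), §6.3 (shape of the consumer).
  [ChambertLoir2002Bourbaki]
-/

noncomputable section

open PowerSeries Finset Literature.NumberTheory.EllipticCurves

namespace Literature.NumberTheory.EllipticCurves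

/-! ### Valuations of products of prime powers; `m! ∣ D·N` prime by prime -/

/-- `v_p(∏_{q ∈ T} q^{e q}) = e p` if `p ∈ T`, else `0`, for a finite set `T` of primes.
[folklore] -/
theorem factorization_prod_prime_pow {T : Finset ℕ} (hT : ∀ q ∈ T, q.Prime) (e : ℕ → ℕ) (p : ℕ) :
    (∏ q ∈ T, q ^ e q).factorization p = if p ∈ T then e p else 0 := by
  rw [Nat.factorization_prod fun q hq => pow_ne_zero _ (hT q hq).ne_zero, Finset.sum_apply']
  have : ∀ q ∈ T, (q ^ e q).factorization p = if q = p then e q else 0 := fun q hq => by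
    rw [(hT q hq).factorization_pow, Finsupp.single_apply]
  rw [sum_congr rfl this, sum_ite_eq']

/-- A product of powers of primes is positive. [folklore] -/
theorem prod_prime_pow_pos {T : Finset ℕ} (hT : ∀ q ∈ T, q.Prime) (e : ℕ → ℕ) :
    0 < ∏ q ∈ T, q ^ e q :=
  prod_pos fun q hq => pow_pos (hT q hq).pos _

/-- **`m! ∣ D·N` prime by prime**: if `v_p(m!) ≤ v_p(D) + v_p(|N|)` for every prime `p`
(`D ≠ 0`, `N ≠ 0`), then `(m! : ℤ) ∣ D·N`. [folklore] -/
theorem int_factorial_dvd_of_factorization_le {m D : ℕ} {N : ℤ} (hD : D ≠ 0) (hN : N ≠ 0)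
    (h : ∀ p, p.Prime →
      (m.factorial).factorization p ≤ D.factorization p + N.natAbs.factorization p) :
    (m.factorial : ℤ) ∣ (D : ℤ) * N := by
  rw [Int.natCast_dvd, Int.natAbs_mul, Int.natAbs_natCast]
  have hN' : N.natAbs ≠ 0 := Int.natAbs_ne_zero.mpr hN
  refine (Nat.factorization_le_iff_dvd (Nat.factorial_ne_zero m) (mul_ne_zero hD hN')).mp ?_
  intro p
  rw [Nat.factorization_mul hD hN', Finsupp.add_apply]
  by_cases hp : p.Prime
  · exact h p hp
  · simp [Nat.factorization_eq_zero_of_not_prime _ hp]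

/-- **Legendre**: `v_p(m!) = v_p(⌊m/p⌋!) + ⌊m/p⌋`. [folklore] -/
theorem padicValNat_factorial_eq_div_add (p : ℕ) [Fact p.Prime] (m : ℕ) :
    padicValNat p m.factorial = padicValNat p (m / p).factorial + m / p := by
  conv_lhs => rw [← Nat.div_add_mod m p]
  rw [padicValNat_factorial_mul_add (m / p) (Nat.mod_lt m (Fact.out : p.Prime).pos),
    padicValNat_factorial_mul]

/-- `v_p` of factorials is monotone. [folklore] -/
theorem factorization_factorial_mono {a b : ℕ} (h : a ≤ b) (p : ℕ) :
    (a.factorial).factorization p ≤ (b.factorial).factorization p :=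
  (Nat.factorization_le_iff_dvd (Nat.factorial_ne_zero a) (Nat.factorial_ne_zero b)).mpr
    (Nat.factorial_dvd_factorial h) p

/-! ### The growth bound `∏_{2 ≤ m ≤ n} m^{1/(m(m-1))} ≤ 2e²` -/

/-- `(1 + 1/n)^{1/n} ≤ exp(1/n²)`. [folklore] -/
theorem one_add_inv_rpow_inv_le (n : ℕ) (hn : 0 < n) :
    ((1 : ℝ) + 1 / n) ^ ((1 : ℝ) / n) ≤ Real.exp (1 / (n : ℝ) ^ 2) := by
  have hn' : (0 : ℝ) < n := Nat.cast_pos.mpr hn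
  have h1 : (1 : ℝ) + 1 / n ≤ Real.exp (1 / n) := by
    have := Real.add_one_le_exp (1 / (n : ℝ))
    linarith
  have h0 : (0 : ℝ) ≤ 1 + 1 / n := by positivity
  calc ((1 : ℝ) + 1 / n) ^ ((1 : ℝ) / n)
      ≤ (Real.exp (1 / n)) ^ ((1 : ℝ) / n) := Real.rpow_le_rpow h0 h1 (by positivity)
    _ = Real.exp (1 / (n : ℝ) ^ 2) := by
        rw [← Real.exp_mul]
        congr 1
        field_simp

/-- **`Q_n := (∏_{2 ≤ m ≤ n} m^{1/(m(m-1))}) · n^{1/n} ≤ 2·exp(2 - 2/n)`** for `n ≥ 1`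
(`Q_{n+1} = Q_n · (1 + 1/n)^{1/n} ≤ Q_n e^{1/n²}` and `1/n² ≤ 2/n - 2/(n+1)`). [folklore] -/
theorem prod_rpow_mul_rpow_le (n : ℕ) (hn : 1 ≤ n) :
    (∏ m ∈ Ioc 1 n, (m : ℝ) ^ ((1 : ℝ) / (m * (m - 1)))) * (n : ℝ) ^ ((1 : ℝ) / n) ≤
      2 * Real.exp (2 - 2 / n) := by
  induction n, hn using Nat.le_induction with
  | base => simp
  | succ n hn ih =>
    have hn0 : (0 : ℝ) < n := Nat.cast_pos.mpr hn
    have hn1 : (0 : ℝ) < n + 1 := by linarith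
    have hnz : (n : ℝ) ≠ 0 := hn0.ne'
    rw [prod_Ioc_succ_top hn]
    push_cast
    have hexp : ((n : ℝ) + 1) ^ ((1 : ℝ) / ((n + 1) * (n + 1 - 1))) * ((n : ℝ) + 1) ^ ((1 : ℝ) / (n + 1))
        = ((n : ℝ) + 1) ^ ((1 : ℝ) / n) := by
      rw [← Real.rpow_add hn1]
      congr 1
      have h11 : (n : ℝ) + 1 - 1 = n := by ring
      rw [h11, div_add_div _ _ (mul_ne_zero hn1.ne' hnz) hn1.ne',
        div_eq_div_iff (mul_ne_zero (mul_ne_zero hn1.ne' hnz) hn1.ne') hnz]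
      ring
    have hpow0 : (n : ℝ) ^ ((1 : ℝ) / n) ≠ 0 := (Real.rpow_pos_of_pos hn0 _).ne'
    have hQ : (∏ m ∈ Ioc 1 n, (m : ℝ) ^ ((1 : ℝ) / (m * (m - 1)))) *
          ((n : ℝ) + 1) ^ ((1 : ℝ) / ((n + 1) * (n + 1 - 1))) * ((n : ℝ) + 1) ^ ((1 : ℝ) / (n + 1)) =
        (∏ m ∈ Ioc 1 n, (m : ℝ) ^ ((1 : ℝ) / (m * (m - 1)))) * (n : ℝ) ^ ((1 : ℝ) / n) *
          ((1 + 1 / n) ^ ((1 : ℝ) / n)) := by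
      rw [mul_assoc, hexp, show (1 : ℝ) + 1 / n = (n + 1) / n by field_simp,
        Real.div_rpow hn1.le hn0.le]
      field_simp
    rw [hQ]
    have hP0 : 0 ≤ (∏ m ∈ Ioc 1 n, (m : ℝ) ^ ((1 : ℝ) / (m * (m - 1)))) * (n : ℝ) ^ ((1 : ℝ) / n) :=
      mul_nonneg (prod_nonneg fun m _ => Real.rpow_nonneg (Nat.cast_nonneg m) _)
        (Real.rpow_nonneg hn0.le _)
    calc _ ≤ 2 * Real.exp (2 - 2 / n) * Real.exp (1 / (n : ℝ) ^ 2) :=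
          mul_le_mul ih (one_add_inv_rpow_inv_le n hn) (Real.rpow_nonneg (by positivity) _)
            (by positivity)
      _ = 2 * Real.exp (2 - 2 / n + 1 / (n : ℝ) ^ 2) := by rw [mul_assoc, ← Real.exp_add]
      _ ≤ 2 * Real.exp (2 - 2 / (n + 1)) := by
          refine mul_le_mul_of_nonneg_left (Real.exp_le_exp.mpr ?_) (by norm_num)
          have h1 : (1 : ℝ) ≤ n := by exact_mod_cast hn
          rw [show (2 : ℝ) - 2 / n + 1 / (n : ℝ) ^ 2 = 2 - (2 * n - 1) / (n : ℝ) ^ 2 by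
            field_simp; ring]
          have key : (2 : ℝ) / (n + 1) ≤ (2 * n - 1) / (n : ℝ) ^ 2 := by
            rw [div_le_div_iff₀ hn1 (by positivity)]
            nlinarith
          linarith

/-- **`∏_{2 ≤ m ≤ n} m^{1/(m(m-1))} ≤ 2e²`** for every `n`. [folklore] -/
theorem prod_rpow_le (n : ℕ) :
    ∏ m ∈ Ioc 1 n, (m : ℝ) ^ ((1 : ℝ) / (m * (m - 1))) ≤ 2 * Real.exp 2 := by
  rcases Nat.eq_zero_or_pos n with rfl | hn
  · rw [Finset.Ioc_eq_empty (by omega), prod_empty]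
    have := Real.add_one_le_exp (2 : ℝ)
    linarith
  have hP0 : 0 ≤ ∏ m ∈ Ioc 1 n, (m : ℝ) ^ ((1 : ℝ) / (m * (m - 1))) :=
    prod_nonneg fun m _ => Real.rpow_nonneg (Nat.cast_nonneg m) _
  have h1 : (1 : ℝ) ≤ (n : ℝ) ^ ((1 : ℝ) / n) :=
    Real.one_le_rpow (by exact_mod_cast hn) (by positivity)
  calc ∏ m ∈ Ioc 1 n, (m : ℝ) ^ ((1 : ℝ) / (m * (m - 1)))
      ≤ (∏ m ∈ Ioc 1 n, (m : ℝ) ^ ((1 : ℝ) / (m * (m - 1)))) * (n : ℝ) ^ ((1 : ℝ) / n) :=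
        le_mul_of_one_le_right hP0 h1
    _ ≤ 2 * Real.exp (2 - 2 / n) := prod_rpow_mul_rpow_le n hn
    _ ≤ 2 * Real.exp 2 := by
        refine mul_le_mul_of_nonneg_left (Real.exp_le_exp.mpr ?_) (by norm_num)
        have : (0 : ℝ) ≤ 2 / n := by positivity
        linarith

/-- **`p^{v_p(⌊n/p⌋!)} ≤ (p^{1/(p(p-1))})ⁿ`** for a prime `p` (Legendre: `(p-1)·v_p(k!) ≤ k`).
[folklore] -/
theorem pow_padicValNat_factorial_div_le (p : ℕ) [Fact p.Prime] (n : ℕ) :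
    ((p : ℝ)) ^ padicValNat p (n / p).factorial ≤
      ((p : ℝ) ^ ((1 : ℝ) / (p * (p - 1)))) ^ n := by
  have hp : p.Prime := Fact.out
  have hp1 : (1 : ℝ) ≤ p := by exact_mod_cast hp.one_lt.le
  have hp0 : (0 : ℝ) < p := by linarith
  have hpm1 : (0 : ℝ) < (p : ℝ) - 1 := by
    have : (2 : ℝ) ≤ p := by exact_mod_cast hp.two_le
    linarith
  -- Legendre: `(p - 1) v ≤ n / p`
  have hL : ((p - 1 : ℕ) : ℝ) * (padicValNat p (n / p).factorial : ℝ) ≤ ((n / p : ℕ) : ℝ) := by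
    have h := sub_one_mul_padicValNat_factorial (p := p) (n / p)
    have h' : (p - 1) * padicValNat p (n / p).factorial ≤ n / p := by rw [h]; exact Nat.sub_le _ _
    exact_mod_cast h'
  have hcast : ((p - 1 : ℕ) : ℝ) = (p : ℝ) - 1 := by
    rw [Nat.cast_sub hp.one_lt.le, Nat.cast_one]
  rw [hcast] at hL
  have hdiv : ((n / p : ℕ) : ℝ) ≤ (n : ℝ) / p := Nat.cast_div_le
  have hv : (padicValNat p (n / p).factorial : ℝ) ≤ (n : ℝ) / (p * (p - 1)) := by
    rw [le_div_iff₀ (mul_pos hp0 hpm1)]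
    calc (padicValNat p (n / p).factorial : ℝ) * (p * (p - 1))
        = (((p : ℝ) - 1) * (padicValNat p (n / p).factorial : ℝ)) * p := by ring
      _ ≤ ((n / p : ℕ) : ℝ) * p := mul_le_mul_of_nonneg_right hL hp0.le
      _ ≤ (n : ℝ) / p * p := mul_le_mul_of_nonneg_right hdiv hp0.le
      _ = n := by field_simp
  calc ((p : ℝ)) ^ padicValNat p (n / p).factorial
      = (p : ℝ) ^ ((padicValNat p (n / p).factorial : ℕ) : ℝ) := (Real.rpow_natCast _ _).symm
    _ ≤ (p : ℝ) ^ ((n : ℝ) / (p * (p - 1))) := Real.rpow_le_rpow_of_exponent_le hp1 hv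
    _ = ((p : ℝ) ^ ((1 : ℝ) / (p * (p - 1)))) ^ n := by
        rw [← Real.rpow_natCast, ← Real.rpow_mul hp0.le]
        congr 1
        ring

/-- **`∏_{p ≤ n prime} p^{v_p(⌊n/p⌋!)} ≤ (2e²)ⁿ`.** [cite: Bost2001AlgebraicLeaves, Prop. 3.9 (2)
and (3.10)] -/
theorem prod_prime_pow_padicValNat_factorial_div_le (n : ℕ) :
    ((∏ p ∈ (range (n + 1)).filter Nat.Prime, p ^ padicValNat p (n / p).factorial : ℕ) : ℝ) ≤
      (2 * Real.exp 2) ^ n := by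
  rw [Nat.cast_prod]
  have h1 : ∀ p ∈ (range (n + 1)).filter Nat.Prime,
      ((p ^ padicValNat p (n / p).factorial : ℕ) : ℝ) ≤ ((p : ℝ) ^ ((1 : ℝ) / (p * (p - 1)))) ^ n := by
    intro p hp
    haveI : Fact p.Prime := ⟨(mem_filter.mp hp).2⟩
    rw [Nat.cast_pow]
    exact pow_padicValNat_factorial_div_le p n
  have h2 : ∀ p ∈ (range (n + 1)).filter Nat.Prime,
      (0 : ℝ) ≤ ((p ^ padicValNat p (n / p).factorial : ℕ) : ℝ) := fun p _ => Nat.cast_nonneg _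
  refine (prod_le_prod h2 h1).trans ?_
  rw [prod_pow]
  refine pow_le_pow_left₀ (prod_nonneg fun p _ => Real.rpow_nonneg (Nat.cast_nonneg p) _) ?_ n
  -- compare with the product over all `2 ≤ m ≤ n`
  have hsub : (range (n + 1)).filter Nat.Prime ⊆ Ioc 1 n := by
    intro p hp
    obtain ⟨hpr, hpp⟩ := mem_filter.mp hp
    exact mem_Ioc.mpr ⟨hpp.one_lt, Nat.lt_succ_iff.mp (mem_range.mp hpr)⟩
  calc ∏ p ∈ (range (n + 1)).filter Nat.Prime, (p : ℝ) ^ ((1 : ℝ) / (p * (p - 1)))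
      = ∏ m ∈ Ioc 1 n, if m ∈ (range (n + 1)).filter Nat.Prime then
          (m : ℝ) ^ ((1 : ℝ) / (m * (m - 1))) else 1 := by
        rw [prod_ite_mem, inter_eq_right.mpr hsub]
    _ ≤ ∏ m ∈ Ioc 1 n, (m : ℝ) ^ ((1 : ℝ) / (m * (m - 1))) := by
        refine prod_le_prod (fun m _ => ?_) (fun m hm => ?_)
        · split_ifs
          · exact Real.rpow_nonneg (Nat.cast_nonneg m) _
          · exact zero_le_one
        · split_ifs
          · exact le_rfl
          · have hm1 : (1 : ℝ) ≤ m := by exact_mod_cast (mem_Ioc.mp hm).1.le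
            refine Real.one_le_rpow hm1 ?_
            have : (0 : ℝ) ≤ (m : ℝ) - 1 := by linarith
            positivity
    _ ≤ 2 * Real.exp 2 := prod_rpow_le n

end Literature.NumberTheory.EllipticCurves

/-! ### The packaged denominators -/

namespace WeierstrassCurve

open Literature.NumberTheory.EllipticCurves

/-- **A geometric common denominator for the powers of the formal leaf.** Let `W, W'` be
Weierstrass equations over `ℤ` and `S` a finite set of natural numbers containing `2` such that at
every prime `p ∉ S` the Hasse invariants of `W mod p` and `W' mod p` agree. Then there is
`Den : ℕ → ℕ` with `0 < Den n ≤ (2e² ∏_{p ∈ S prime} p)ⁿ` and `Den n · [xᵐ](yʲ) ∈ ℤ` for all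
`m ≤ n` and all `j`, where `y = exp_{W'}(log_W x) ∈ ℚ⟦x⟧`. (`Den n = ∏_{p ≤ n} p^{e_p(n)}`,
`e_p(n) = v_p(n!)` for `p ∈ S`, `= v_p(⌊n/p⌋!)` for `p ∉ S`.) This is the input
"`τ(y) = Σ_p log R_p⁻¹ < ∞`" of André's criterion for the leaf of Bost's foliation of `E × E'`.
[cite: Bost2001AlgebraicLeaves, Prop. 3.9 (2) and §3.4.3] -/
theorem exists_den_leaf (W W' : WeierstrassCurve ℤ) (S : Finset ℕ) (h2 : 2 ∈ S)
    (hS : ∀ p, p.Prime → p ∉ S →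
      (W.map (Int.castRingHom (ZMod p))).hasseCoeff p = (W'.map (Int.castRingHom (ZMod p))).hasseCoeff p) :
    ∃ Den : ℕ → ℕ, (∀ n, 0 < Den n) ∧
      (∀ n, (Den n : ℝ) ≤ ((2 * Real.exp 2) * ((∏ p ∈ S.filter Nat.Prime, p : ℕ) : ℝ)) ^ n) ∧
      ∀ n m j, m ≤ n → ∃ z : ℤ, (Den n : ℚ) *
        coeff m (((W'.map (Int.castRingHom ℚ)).formalExp.subst (W.map (Int.castRingHom ℚ)).formalLog) ^ j)
          = z := by
  classical
  -- the exponents and the denominator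
  set e : ℕ → ℕ → ℕ := fun n p =>
    if p ∈ S then padicValNat p n.factorial else padicValNat p (n / p).factorial with he
  set T : ℕ → Finset ℕ := fun n => (range (n + 1)).filter Nat.Prime with hT
  have hTprime : ∀ n, ∀ q ∈ T n, q.Prime := fun n q hq => (mem_filter.mp hq).2
  refine ⟨fun n => ∏ q ∈ T n, q ^ e n q, fun n => prod_prime_pow_pos (hTprime n) _, fun n => ?_,
    fun n m j hmn => ?_⟩
  · -- growth
    have hsplit : (∏ q ∈ T n, q ^ e n q : ℕ) ≤
        (∏ q ∈ (T n).filter (· ∈ S), q ^ n) * ∏ q ∈ T n, q ^ padicValNat q (n / q).factorial := by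
      rw [← prod_filter_mul_prod_filter_not (T n) (· ∈ S)]
      refine Nat.mul_le_mul ?_ ?_
      · refine prod_le_prod' fun q hq => ?_
        obtain ⟨hqT, hqS⟩ := mem_filter.mp hq
        haveI : Fact q.Prime := ⟨hTprime n q hqT⟩
        simp only [he, if_pos hqS]
        exact Nat.pow_le_pow_right (hTprime n q hqT).pos (padicValNat_factorial_le q n)
      · calc ∏ q ∈ (T n).filter (fun q => ¬ q ∈ S), q ^ e n q
            = ∏ q ∈ (T n).filter (fun q => ¬ q ∈ S), q ^ padicValNat q (n / q).factorial :=
              prod_congr rfl fun q hq => by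
                simp only [he, if_neg (mem_filter.mp hq).2]
          _ ≤ ∏ q ∈ T n, q ^ padicValNat q (n / q).factorial :=
              prod_le_prod_of_subset_of_one_le' (filter_subset _ _) fun q hq _ =>
                Nat.one_le_pow _ _ (hTprime n q hq).pos
    have hA : ((∏ q ∈ (T n).filter (· ∈ S), q ^ n : ℕ) : ℝ) ≤
        (((∏ p ∈ S.filter Nat.Prime, p : ℕ) : ℝ)) ^ n := by
      rw [prod_pow, Nat.cast_pow]
      refine pow_le_pow_left₀ (Nat.cast_nonneg _) ?_ n
      exact_mod_cast prod_le_prod_of_subset_of_one_le' (fun q hq => by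
        obtain ⟨hqT, hqS⟩ := mem_filter.mp hq
        exact mem_filter.mpr ⟨hqS, hTprime n q hqT⟩) fun q hq _ => Nat.Prime.pos (mem_filter.mp hq).2
    calc ((∏ q ∈ T n, q ^ e n q : ℕ) : ℝ)
        ≤ ((∏ q ∈ (T n).filter (· ∈ S), q ^ n : ℕ) : ℝ) *
            ((∏ q ∈ T n, q ^ padicValNat q (n / q).factorial : ℕ) : ℝ) := by exact_mod_cast hsplit
      _ ≤ (((∏ p ∈ S.filter Nat.Prime, p : ℕ) : ℝ)) ^ n * (2 * Real.exp 2) ^ n :=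
          mul_le_mul hA (prod_prime_pow_padicValNat_factorial_div_le n) (Nat.cast_nonneg _)
            (pow_nonneg (Nat.cast_nonneg _) n)
      _ = ((2 * Real.exp 2) * ((∏ p ∈ S.filter Nat.Prime, p : ℕ) : ℝ)) ^ n := by ring
  · -- integrality
    obtain ⟨N, hN⟩ := exists_int_factorial_mul_coeff_pow' W W' j m
    have hm0 : (m.factorial : ℚ) ≠ 0 := by exact_mod_cast Nat.factorial_ne_zero m
    have hcoeff : coeff m (((W'.map (Int.castRingHom ℚ)).formalExp.subst
        (W.map (Int.castRingHom ℚ)).formalLog) ^ j) = (N : ℚ) / m.factorial := by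
      rw [eq_div_iff hm0, mul_comm, hN]
    rw [hcoeff]
    by_cases hN0 : N = 0
    · exact ⟨0, by simp [hN0]⟩
    have hD0 : (∏ q ∈ T n, q ^ e n q) ≠ 0 := (prod_prime_pow_pos (hTprime n) _).ne'
    have hdvd : (m.factorial : ℤ) ∣ ((∏ q ∈ T n, q ^ e n q : ℕ) : ℤ) * N := by
      refine int_factorial_dvd_of_factorization_le hD0 hN0 fun p hp => ?_
      haveI : Fact p.Prime := ⟨hp⟩
      rw [factorization_prod_prime_pow (hTprime n) (e n) p]
      by_cases hpn : p ∈ T n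
      · rw [if_pos hpn]
        simp only [he]
        by_cases hpS : p ∈ S
        · rw [if_pos hpS, ← Nat.factorization_def _ hp]
          exact (factorization_factorial_mono hmn p).trans (Nat.le_add_right _ _)
        · rw [if_neg hpS]
          -- `v_p(m!) = v_p((m/p)!) + m/p ≤ v_p((n/p)!) + v_p(N)`
          have hp2 : p ≠ 2 := fun h => hpS (h ▸ h2)
          obtain ⟨M, hM⟩ := exists_int_factorial_mul_coeff_pow p W W' hp2 (hS p hp hpS) j m
          have hNM : N = (p : ℤ) ^ (m / p) * M := by
            have : ((N : ℤ) : ℚ) = (((p : ℤ) ^ (m / p) * M : ℤ) : ℚ) := by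
              rw [← hN, hM]; push_cast; ring
            exact_mod_cast this
          have hvN : m / p ≤ N.natAbs.factorization p := by
            refine (hp.pow_dvd_iff_le_factorization (Int.natAbs_ne_zero.mpr hN0)).mp ?_
            rw [hNM, Int.natAbs_mul, Int.natAbs_pow, Int.natAbs_natCast]
            exact dvd_mul_right _ _
          rw [Nat.factorization_def _ hp, padicValNat_factorial_eq_div_add p m,
            ← Nat.factorization_def _ hp, ← Nat.factorization_def _ hp]
          exact add_le_add (factorization_factorial_mono (Nat.div_le_div_right hmn) p) hvN
      · -- primes `> n` do not divide `m!`
        rw [if_neg hpn, zero_add]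
        have hpm : ¬ p ∣ m.factorial := fun h => hpn (mem_filter.mpr
          ⟨mem_range.mpr (Nat.lt_succ_of_le ((hp.dvd_factorial.mp h).trans hmn)), hp⟩)
        rw [Nat.factorization_eq_zero_of_not_dvd hpm]
        exact Nat.zero_le _
    obtain ⟨z, hz⟩ := hdvd
    refine ⟨z, ?_⟩
    rw [mul_div_assoc', div_eq_iff hm0, mul_comm (z : ℚ)]
    exact_mod_cast hz

/-- **The packaged denominators for two elliptic curves over `ℚ` with `a_p(E) = a_p(E')` for
almost all `p`.** For globally minimal `E, E'` over `ℚ` whose traces of Frobenius differ at only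
finitely many primes there are `Den : ℕ → ℕ` and `C` with `0 < Den n ≤ Cⁿ` and
`Den n · [xᵐ](yʲ) ∈ ℤ` for all `m ≤ n`, `j`, where `y = exp_{E'}(log_E x) ∈ ℚ⟦x⟧` is the formal
leaf of Bost's line `h ⊂ Lie E ⊕ Lie E'` (exceptional set: `2`, the primes dividing
`Δ_E Δ_{E'}`, and those with `a_p ≠ a'_p`; elsewhere `a_p ≡ A_p (mod p)` makes the Hasse
invariants agree). This is hypothesis i) (`p`-adic sizes, `Σ log R_p⁻¹ < ∞`) of Bost's Theorem 2.1
/ 3.4 for the foliation of `E × E'` in the proof of Cor. 2.5, in the form of the integer row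
denominators of André's criterion over `ℚ`. [cite: Bost2001AlgebraicLeaves, Cor. 2.5 (proof) and
Prop. 3.9] -/
theorem exists_den_leaf_of_finite (W₀ W₀' : WeierstrassCurve ℚ) [W₀.IsElliptic] [W₀'.IsElliptic]
    [W₀.IsGloballyMinimal] [W₀'.IsGloballyMinimal]
    (hfin : {p : ℕ | p.Prime ∧ W₀.frobeniusTrace p ≠ W₀'.frobeniusTrace p}.Finite) :
    ∃ (Den : ℕ → ℕ) (C : ℝ), (∀ n, 0 < Den n) ∧ (∀ n, (Den n : ℝ) ≤ C ^ n) ∧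
      ∀ n m j, m ≤ n → ∃ z : ℤ, (Den n : ℚ) * coeff m ((W₀'.formalExp.subst W₀.formalLog) ^ j) = z := by
  classical
  have hΔ : ∀ (W₁ : WeierstrassCurve ℚ) [W₁.IsElliptic] [W₁.IsGloballyMinimal],
      (integralModelInt W₁).Δ ≠ 0 := by
    intro W₁ _ _ h
    have h1 := congrArg WeierstrassCurve.Δ (map_integralModelInt W₁)
    rw [map_Δ, eq_intCast, h, Int.cast_zero] at h1
    exact W₁.isUnit_Δ.ne_zero h1.symm
  set V := integralModelInt W₀ with hV
  set V' := integralModelInt W₀' with hV'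
  have hVV : V.Δ * V'.Δ ≠ 0 := mul_ne_zero (hΔ W₀) (hΔ W₀')
  set S : Finset ℕ := insert 2 ((V.Δ * V'.Δ).natAbs.primeFactors ∪ hfin.toFinset) with hSdef
  have hS : ∀ p, p.Prime → p ∉ S →
      (V.map (Int.castRingHom (ZMod p))).hasseCoeff p = (V'.map (Int.castRingHom (ZMod p))).hasseCoeff p := by
    intro p hp hpS
    haveI : Fact p.Prime := ⟨hp⟩
    rw [hSdef, mem_insert, not_or, mem_union, not_or] at hpS
    obtain ⟨hp2, hpΔ, hpa⟩ := hpS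
    have hdvd : ¬ (p : ℤ) ∣ V.Δ * V'.Δ := fun h =>
      hpΔ (Nat.mem_primeFactors.mpr ⟨hp, Int.natCast_dvd.mp h, Int.natAbs_ne_zero.mpr hVV⟩)
    have hap : W₀.frobeniusTrace p = W₀'.frobeniusTrace p := by
      by_contra h
      exact hpa (hfin.mem_toFinset.mpr ⟨hp, h⟩)
    haveI : (V.map (Int.castRingHom (ZMod p))).IsElliptic := by
      rw [isElliptic_iff, map_Δ, isUnit_iff_ne_zero, eq_intCast, Ne, ZMod.intCast_zmod_eq_zero_iff_dvd]
      exact fun h => hdvd (dvd_mul_of_dvd_left h _)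
    haveI : (V'.map (Int.castRingHom (ZMod p))).IsElliptic := by
      rw [isElliptic_iff, map_Δ, isUnit_iff_ne_zero, eq_intCast, Ne, ZMod.intCast_zmod_eq_zero_iff_dvd]
      exact fun h => hdvd (dvd_mul_of_dvd_right h _)
    exact hasseCoeff_reduction_eq_of_frobeniusTrace_eq W₀ W₀' p hp2 hap
  obtain ⟨Den, h0, hC, hZ⟩ := exists_den_leaf V V' S (mem_insert_self _ _) hS
  refine ⟨Den, _, h0, hC, ?_⟩
  simpa only [hV, hV', map_integralModelInt] using hZ

end WeierstrassCurve

end
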